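import Mathlib.LinearAlgebra.Matrix.Determinant.Basic
import Mathlib.Data.Finset.Sort
import Mathlib.Data.Nat.Digits.Defs
import Literature.Computability.Cryptography.QubitRegister
import HarnessLib

/-!
# Slater determinant states under the Jordan–Wigner encoding

Trunk `Literature/Computability/QuantumComplexity`; definition request `defn-slaterState` (route
QuantumAdvantage/FermionicMagic, items 2476–2478, 2482, 2483, which inline the lambdas below).

Over the tree's qubit registers `QReg n = Fin n → Bool` (`QubitRegister.lean`; qubit value
`true` = occupied fermionic mode):

* `occupied x` — the finset of occupied sites of `x`;
* `slaterState φ` — for `k` orbitals `φ : Fin k → Fin n → R` (rows), the state vector whose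
  amplitude on an occupation pattern `x` with occupied sites `j₀ < ⋯ < j_{k-1}` is the `k × k`
  determinant `det [φ a (j_b)]_{a,b<k}` (rows = orbitals in the given order, columns = occupied
  sites ascending, `Finset.orderEmbOfFin`), and `0` off the `k`-particle sector. This is the
  Jordan–Wigner image of the Slater determinant `ψ†(φ₀) ψ†(φ₁) ⋯ ψ†(φ_{k-1}) |vac⟩`,
  `ψ†(φ) = ∑ⱼ φ(j) a†ⱼ`, with Terhal–DiVincenzo's convention
  `a†ⱼ |x⟩ = δ_{xⱼ,0} (-1)^{x₀+⋯+x_{j-1}} |x with xⱼ := 1⟩`: their formula `⟨y|U|x⟩ = det Ṽ`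
  (PRA 65 (2002) 032325, §3) is exactly this determinant;
* `ringFermiSea n` — the half-filled chiral Fermi sea on the ring `ℤ/n`: `k = ⌊n/2⌋` plane waves
  `φ_a(j) = e^{2πi a j/n}/√n`;
* `fermiBall r`, `walsh r`, `cubeFermiSea r` — the half-filled ground state of free fermions
  hopping on the hypercube `Q_r` (`n = 2^r` sites read as `r`-bit strings): the Slater determinant
  of the Walsh characters `χ_a(j) = (-1)^{|a ∧ j|}/√(2^r)` for `a` in the Hamming ball
  `{a : 2|a| < r}` enumerated increasingly (Bernard–Crampé–Vinet 2023).

The bodies of `slaterState`, `ringFermiSea`, `cubeFermiSea` are, up to `δ`/`β`-unfolding, the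
lambdas inlined in `Summits/QuantumAdvantage/QuantumAdvantage/Theses/FermionicMagic.lean`
(`FermiSeaApproxRank`, `CubeSeaExactRank`, `CubeSeaApproxRank`, `FermiSeaPrep`, `CubeSeaPrep`), so
that restating those items over these names is `Iff.rfl`.

## API (all proved)

* `slaterState_apply`, `slaterState_of_card_eq`, `slaterState_of_card_ne` (off-sector vanishing);
* `slaterState_matrix_mul` — `GL_k`-covariance `slaterState (M φ) = det M • slaterState φ`
  (Plücker), `slaterState_perm` (antisymmetry in the orbitals), `slaterState_row_add_smul`
  (row operations), `slaterState_eq_zero_of_not_linearIndependent`;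
* `slaterState_col_scale` — functoriality under diagonal one-body operators
  `Γ(diag d)`: scaling the orbitals sitewise by `d` multiplies the amplitude on `x` by
  `∏_{j occupied} d j`;
* `slaterState_indicator` / `basisState_eq_slaterState` — Fock basis states are Slater
  determinants of indicator orbitals;
* `map_slaterState` — change of scalars along a ring hom;
* `det_mul_eq_sum_occupied` — the Cauchy–Binet formula in occupation-pattern form, and its
  consequences `normSq_slaterState` (`‖slaterState φ‖² = det (Φ Φᴴ)`, the Gram determinant) and
  `normSq_slaterState_of_orthonormal` (`= 1` for orthonormal orbitals).

Restriction to a measured site (Slater ↦ Slater, Laplace expansion) and the action of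
nearest-neighbour number-preserving matchgates are in `SlaterStateRestriction.lean`.

## References

* B. M. Terhal, D. P. DiVincenzo, *Classical simulation of noninteracting-fermion quantum
  circuits*, Phys. Rev. A 65 (2002) 032325, §3 (`⟨y|U|x⟩ = det Ṽ`, rows = input modes,
  columns = occupied output modes, both ascending; Jordan–Wigner signs). [TerhalDivincenzo2002]
* R. Jozsa, A. Miyake, *Matchgates and classical simulation of quantum circuits*, Proc. R. Soc.
  A 464 (2008) 3089–3106, §1 eq. (1) (`G(A,B)`), §5 (Jordan–Wigner). [JozsaMiyake2008]
* P.-A. Bernard, N. Crampé, L. Vinet, *Entanglement of free fermions on Hamming graphs*,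
  Nucl. Phys. B 986 (2023) 116061 (arXiv:2103.15742), §2.1 eqs. (12)–(16) (spectrum of the
  Hamming graph `H(d,q)`, eigenspaces labelled by `b ∈ 𝔽₂^d`), §2.2 eq. (19) (ground state =
  Fermi sea of the levels `Ω_k < 0`). [BernardCrampeVinet2023]
* F. R. Gantmacher, *The Theory of Matrices* I, Chelsea 1959, Ch. I §2 (Binet–Cauchy formula).

## Design choices

* Scalars: `slaterState` is defined over any commutative ring `R` (Mathlib generality; e.g. the
  hypercube amplitudes are integer Hadamard minors over `2^{r|K|/2}`), the two families over `ℂ`.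
* No normalisation or orthonormality is imposed on the orbitals (the determinant formula is
  meaningful for any `φ`; `normSq_slaterState` computes the norm).
* The Cauchy–Binet formula is proved here (Mathlib at this pin has `det_mul` for square
  matrices only; the tree's `Literature.Analysis.TotalPositivity.det_mul_eq_sum_strictMono` is
  the increasing-map form, re-proved here in occupation-pattern form to keep this file's import
  cone inside `QubitRegister.lean`).
* Not here: second quantisation / CAR algebra (the tree's
  `Literature.MathematicalPhysics.QuantumLattice` Fock-space files are first-quantised and
  spinful); Gaussian (non-number-preserving) states; Wick's theorem.
-/

noncomputable section

open Matrix Finset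

namespace Literature.Computability.QuantumComplexity

open Cryptography (QReg basisState normSq)

variable {R : Type*} [CommRing R] {n k : ℕ}

/-! ### Occupied sites -/

/-- The set of occupied sites (qubits in state `true`) of an occupation pattern `x`.
[Terhal–DiVincenzo 2002, §2 (modes occupied `1` / unoccupied `0`)] [folklore] -/
def occupied (x : QReg n) : Finset (Fin n) := univ.filter fun j => x j = true

/-- Membership in the occupied set. [folklore] -/
@[simp] theorem mem_occupied {x : QReg n} {j : Fin n} : j ∈ occupied x ↔ x j = true := by
  simp [occupied]

/-- Two occupation patterns with the same occupied set are equal. [folklore] -/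
theorem occupied_injective : Function.Injective (occupied (n := n)) := by
  intro x y h
  funext j
  have hj := congrArg (fun S => j ∈ S) h
  simp only [mem_occupied, eq_iff_iff] at hj
  cases hx : x j <;> cases hy : y j <;> simp_all

/-- The increasing enumeration of the occupied set takes occupied values. [folklore] -/
theorem occupied_orderEmbOfFin_apply_eq_true {x : QReg n} (h : (occupied x).card = k) (b : Fin k) :
    x ((occupied x).orderEmbOfFin h b) = true :=
  mem_occupied.1 (Finset.orderEmbOfFin_mem _ h b)

/-! ### Slater determinant states -/

/-- **Slater determinant state** (Jordan–Wigner encoding). For `k` orbitals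
`φ : Fin k → Fin n → R` the vector `QReg n → R` whose amplitude on an occupation pattern with
occupied sites `j₀ < ⋯ < j_{k-1}` is `det [φ a j_b]_{a,b<k}` (rows = orbitals in order, columns =
occupied sites ascending), and `0` on patterns with `≠ k` particles: the state
`ψ†(φ₀) ⋯ ψ†(φ_{k-1}) |vac⟩`, `ψ†(φ) = ∑ⱼ φ(j) a†ⱼ`, `a†ⱼ = Z₀ ⋯ Z_{j-1} ⊗ (|1⟩⟨0|)ⱼ` (qubit `true`
= occupied).
[Terhal–DiVincenzo 2002, §3: `⟨y|U|x⟩ = det Ṽ`, `Ṽ` = rows `i₁<⋯<i_k`, columns `l₁<⋯<l_k` of `V`,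
`U a†ᵢ U† = ∑ₘ V_{im} a†ₘ`] [cite: TerhalDivincenzo2002, §3] -/
def slaterState {n k : ℕ} (φ : Fin k → Fin n → R) : QReg n → R := fun x =>
  if h : (Finset.univ.filter fun j => x j = true).card = k then
    (Matrix.of fun a b : Fin k => φ a ((Finset.univ.filter fun j => x j = true).orderEmbOfFin h b)).det
  else 0

/-- Unfolding `slaterState` (with the occupied set named). [folklore] -/
theorem slaterState_apply (φ : Fin k → Fin n → R) (x : QReg n) :
    slaterState φ x = if h : (occupied x).card = k then
      (Matrix.of fun a b : Fin k => φ a ((occupied x).orderEmbOfFin h b)).det else 0 := rfl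

/-- On the `k`-particle sector the amplitude is the `k × k` minor of the orbital matrix on the
occupied columns. [cite: TerhalDivincenzo2002, §3] -/
theorem slaterState_of_card_eq (φ : Fin k → Fin n → R) {x : QReg n} (h : (occupied x).card = k) :
    slaterState φ x = ((Matrix.of φ).submatrix id ((occupied x).orderEmbOfFin h)).det := by
  rw [slaterState_apply, dif_pos h]
  rfl

/-- Off the `k`-particle sector a `k`-orbital Slater determinant state vanishes.
[cite: TerhalDivincenzo2002, §3] -/
theorem slaterState_of_card_ne (φ : Fin k → Fin n → R) {x : QReg n} (h : (occupied x).card ≠ k) :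
    slaterState φ x = 0 := by
  rw [slaterState_apply, dif_neg h]

/-! ### Covariance in the orbitals (Plücker) -/

/-- **`GL_k`-covariance**: replacing the orbitals by linear combinations `φ' = M φ` multiplies the
state by `det M` (the state depends only on the `k`-plane spanned by the orbitals, through its
Plücker coordinates). [folklore] -/
theorem slaterState_matrix_mul (M : Matrix (Fin k) (Fin k) R) (φ : Fin k → Fin n → R) (x : QReg n) :
    slaterState (fun a j => (M * Matrix.of φ) a j) x = M.det * slaterState φ x := by
  by_cases h : (occupied x).card = k
  · rw [slaterState_of_card_eq _ h, slaterState_of_card_eq _ h, ← det_mul]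
    rfl
  · rw [slaterState_of_card_ne _ h, slaterState_of_card_ne _ h, mul_zero]

/-- Antisymmetry: permuting the orbitals multiplies the state by the sign of the permutation.
[folklore] -/
theorem slaterState_perm (σ : Equiv.Perm (Fin k)) (φ : Fin k → Fin n → R) (x : QReg n) :
    slaterState (fun a => φ (σ a)) x = Equiv.Perm.sign σ * slaterState φ x := by
  by_cases h : (occupied x).card = k
  · rw [slaterState_of_card_eq _ h, slaterState_of_card_eq _ h, ← det_permute]
    rfl
  · rw [slaterState_of_card_ne _ h, slaterState_of_card_ne _ h, mul_zero]

/-- Row operations: adding multiples of one orbital to the others does not change the state.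
[folklore] -/
theorem slaterState_row_add_smul (φ : Fin k → Fin n → R) (c : Fin k → R) (a₀ : Fin k) (hc : c a₀ = 0)
    (x : QReg n) :
    slaterState (fun a j => φ a j + c a * φ a₀ j) x = slaterState φ x := by
  by_cases h : (occupied x).card = k
  · rw [slaterState_of_card_eq _ h, slaterState_of_card_eq _ h]
    exact det_eq_of_forall_row_eq_smul_add_const c a₀ hc fun a b => rfl
  · rw [slaterState_of_card_ne _ h, slaterState_of_card_ne _ h]

/-- Linearly dependent orbitals give the zero state. [folklore] -/
theorem slaterState_eq_zero_of_not_linearIndependent [IsDomain R] (φ : Fin k → Fin n → R)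
    (hφ : ¬ LinearIndependent R φ) : slaterState φ = 0 := by
  funext x
  by_cases h : (occupied x).card = k
  · rw [slaterState_of_card_eq _ h, Pi.zero_apply]
    apply det_eq_zero_of_not_linearIndependent_rows
    intro hrows
    exact hφ (LinearIndependent.of_comp
      (LinearMap.funLeft R R ((occupied x).orderEmbOfFin h)) hrows)
  · rw [slaterState_of_card_ne _ h, Pi.zero_apply]

/-! ### Functoriality under diagonal one-body operators; basis states -/

/-- **Diagonal one-body operators**: scaling every orbital sitewise by `d` (the Gaussian
operator `Γ(diag d)`, e.g. `d = ±1` for a string of `Z`'s, phases for `e^{iθ n_j}`) multiplies the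
amplitude on `x` by `∏_{j occupied} d j`. [folklore] -/
theorem slaterState_col_scale (d : Fin n → R) (φ : Fin k → Fin n → R) (x : QReg n) :
    slaterState (fun a j => d j * φ a j) x = (∏ j ∈ occupied x, d j) * slaterState φ x := by
  by_cases h : (occupied x).card = k
  · rw [slaterState_of_card_eq _ h, slaterState_of_card_eq _ h]
    have hM : (Matrix.of fun a j => d j * φ a j).submatrix id ((occupied x).orderEmbOfFin h) =
        (Matrix.of φ).submatrix id ((occupied x).orderEmbOfFin h) *
          Matrix.diagonal (fun b => d ((occupied x).orderEmbOfFin h b)) := by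
      ext a b
      simp [mul_comm]
    rw [hM, det_mul, det_diagonal, mul_comm]
    congr 1
    conv_rhs => rw [← Finset.map_orderEmbOfFin_univ (occupied x) h]
    rw [Finset.prod_map]
    rfl
  · rw [slaterState_of_card_ne _ h, slaterState_of_card_ne _ h, mul_zero]

/-- **Fock basis states are Slater determinants**: the indicator orbitals of the occupied sites
of `y` (in increasing order) give the basis vector `|y⟩`. [Terhal–DiVincenzo 2002, §3
(`|x⟩ = a†_{i₁} ⋯ a†_{i_k} |0⟩`, `i₁ < ⋯ < i_k`)] [cite: TerhalDivincenzo2002, §3] -/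
theorem slaterState_indicator (y x : QReg n) :
    slaterState (fun (a : Fin (occupied y).card) (j : Fin n) =>
      if (occupied y).orderEmbOfFin rfl a = j then (1 : R) else 0) x = if x = y then 1 else 0 := by
  by_cases h : (occupied x).card = (occupied y).card
  · rw [slaterState_of_card_eq _ h]
    by_cases hxy : x = y
    · subst hxy
      rw [if_pos rfl]
      have : (Matrix.of fun (a : Fin (occupied x).card) (j : Fin n) =>
          if (occupied x).orderEmbOfFin rfl a = j then (1 : R) else 0).submatrix id
            ((occupied x).orderEmbOfFin h) = 1 := by
        ext a b
        simp only [submatrix_apply, id_eq, of_apply, Matrix.one_apply,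
          ((occupied x).orderEmbOfFin rfl).injective.eq_iff]
      rw [this, det_one]
    · rw [if_neg hxy]
      -- some occupied site of `x` is not occupied in `y`; its column vanishes
      have hne : occupied x ≠ occupied y := fun he => hxy (occupied_injective he)
      have hns : ¬ occupied x ⊆ occupied y := fun hs => hne (Finset.eq_of_subset_of_card_le hs h.ge)
      obtain ⟨j, hjx, hjy⟩ := Finset.not_subset.1 hns
      obtain ⟨b, hb⟩ : j ∈ Set.range ((occupied x).orderEmbOfFin h) := by
        rw [Finset.range_orderEmbOfFin]; exact hjx
      refine det_eq_zero_of_column_eq_zero b fun a => ?_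
      simp only [submatrix_apply, id_eq, of_apply, hb]
      rw [if_neg]
      rintro rfl
      exact hjy (Finset.orderEmbOfFin_mem _ _ a)
  · rw [slaterState_of_card_ne _ h, if_neg]
    rintro rfl
    exact h rfl

/-- The computational basis state `|y⟩` is the Slater determinant state of the indicator
orbitals of the occupied sites of `y` (e.g. an `X`-layer on the sites of `K` applied to `|0ⁿ⟩`
prepares the Slater determinant of the indicator orbitals of `K`).
[cite: TerhalDivincenzo2002, §3] -/
theorem basisState_eq_slaterState (y : QReg n) :
    basisState y = slaterState (fun (a : Fin (occupied y).card) (j : Fin n) =>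
      if (occupied y).orderEmbOfFin rfl a = j then (1 : ℂ) else 0) := by
  funext x
  rw [slaterState_indicator, Cryptography.basisState_apply]

/-- Change of scalars: a ring hom commutes with `slaterState`. [folklore] -/
theorem map_slaterState {S : Type*} [CommRing S] (f : R →+* S) (φ : Fin k → Fin n → R) (x : QReg n) :
    f (slaterState φ x) = slaterState (fun a j => f (φ a j)) x := by
  by_cases h : (occupied x).card = k
  · rw [slaterState_of_card_eq _ h, slaterState_of_card_eq _ h, RingHom.map_det]
    rfl
  · rw [slaterState_of_card_ne _ h, slaterState_of_card_ne _ h, map_zero]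

/-! ### The Cauchy–Binet formula in occupation-pattern form -/

/-- Expansion of `det (A * B)` over all column selections `p : Fin k → Fin n` (with repetition).
[folklore] -/
theorem det_mul_eq_sum_pi (A : Matrix (Fin k) (Fin n) R) (B : Matrix (Fin n) (Fin k) R) :
    (A * B).det = ∑ p : Fin k → Fin n, (∏ i, B (p i) i) * (A.submatrix id p).det := by
  simp only [det_apply', mul_apply, prod_univ_sum, mul_sum, Fintype.piFinset_univ]
  rw [Finset.sum_comm]
  refine Finset.sum_congr rfl fun p _ => ?_
  refine Finset.sum_congr rfl fun σ _ => ?_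
  simp only [submatrix_apply, id, prod_mul_distrib]
  ring

/-- The occupation pattern of the range of a selection `p : Fin k → Fin n`. [folklore] -/
def rangePattern (p : Fin k → Fin n) : QReg n := fun j => decide (j ∈ univ.image p)

/-- The occupied set of `rangePattern p` is the range of `p`. [folklore] -/
theorem occupied_rangePattern (p : Fin k → Fin n) : occupied (rangePattern p) = univ.image p := by
  ext j
  simp [rangePattern]

/-- Precomposing the enumeration of `occupied x` with a permutation selects the pattern `x`.
[folklore] -/
theorem rangePattern_comp_perm {x : QReg n} (h : (occupied x).card = k) (τ : Equiv.Perm (Fin k)) :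
    rangePattern ((occupied x).orderEmbOfFin h ∘ τ) = x := by
  apply occupied_injective
  rw [occupied_rangePattern, ← Finset.image_image, Finset.image_univ_equiv,
    Finset.image_orderEmbOfFin_univ]

/-- **Cauchy–Binet formula** (occupation-pattern form). For `A : k × n` and `B : n × k`,
`det (A B) = ∑_S det A[·, S] · det B[S, ·]` over the `k`-element subsets `S` of the columns,
written as a sum over occupation patterns `x : QReg n` with `k` particles, the columns
`S = occupied x` enumerated increasingly. [Gantmacher 1959, Ch. I §2 (14)] [folklore] -/
theorem det_mul_eq_sum_occupied (A : Matrix (Fin k) (Fin n) R) (B : Matrix (Fin n) (Fin k) R) :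
    (A * B).det = ∑ x : QReg n, if h : (occupied x).card = k then
      (A.submatrix id ((occupied x).orderEmbOfFin h)).det *
        (B.submatrix ((occupied x).orderEmbOfFin h) id).det else 0 := by
  classical
  rw [det_mul_eq_sum_pi]
  set G : (Fin k → Fin n) → R := fun p => (∏ i, B (p i) i) * (A.submatrix id p).det with hG
  -- only injective selections contribute
  have hL : ∑ p : Fin k → Fin n, G p =
      ∑ p ∈ univ.filter (fun p : Fin k → Fin n => Function.Injective p), G p := by
    refine (Finset.sum_subset (filter_subset _ _) fun p _ hp => ?_).symm
    rw [mem_filter, not_and] at hp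
    have hp' := hp (mem_univ p)
    unfold Function.Injective at hp'
    push Not at hp'
    obtain ⟨i, j, hij, hne⟩ := hp'
    have hdet : (A.submatrix id p).det = 0 :=
      det_zero_of_column_eq hne fun l => by simp [hij]
    simp only [hG, hdet, mul_zero]
  rw [hL, ← Finset.sum_fiberwise (s := univ.filter fun p : Fin k → Fin n => Function.Injective p)
    (g := rangePattern)]
  refine Finset.sum_congr rfl fun x _ => ?_
  by_cases h : (occupied x).card = k
  · rw [dif_pos h]
    set e := (occupied x).orderEmbOfFin h with he
    -- the fibre over `x` is `{e ∘ τ | τ ∈ Perm (Fin k)}`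
    have hfib : (univ.filter fun p : Fin k → Fin n => Function.Injective p).filter
        (fun p => rangePattern p = x) = univ.map ⟨fun τ : Equiv.Perm (Fin k) => (e ∘ τ : Fin k → Fin n),
          fun τ τ' hτ => Equiv.ext fun i => e.injective (congrFun hτ i)⟩ := by
      ext p
      simp only [mem_filter, mem_univ, true_and, mem_map, Function.Embedding.coeFn_mk]
      constructor
      · rintro ⟨hp, hpx⟩
        have hmem : ∀ i, p i ∈ occupied x := fun i => by
          rw [← hpx, occupied_rangePattern]; exact mem_image_of_mem p (mem_univ i)
        let g : Fin k → Fin k := fun i => ((occupied x).orderIsoOfFin h).symm ⟨p i, hmem i⟩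
        have hg : ∀ i, e (g i) = p i := fun i => by
          rw [he, ← Finset.coe_orderIsoOfFin_apply, OrderIso.apply_symm_apply]
        have hginj : Function.Injective g := fun i j hij => hp (by rw [← hg i, ← hg j, hij])
        exact ⟨Equiv.ofBijective g hginj.bijective_of_finite, funext fun i => hg i⟩
      · rintro ⟨τ, rfl⟩
        exact ⟨e.injective.comp τ.injective, rangePattern_comp_perm h τ⟩
    rw [hfib, Finset.sum_map, det_apply' (B.submatrix e id), Finset.mul_sum]
    refine Finset.sum_congr rfl fun τ _ => ?_
    simp only [hG, Function.Embedding.coeFn_mk]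
    have : A.submatrix id (e ∘ ⇑τ) = (A.submatrix id e).submatrix id τ := rfl
    rw [this, det_permute']
    simp only [submatrix_apply, id, Function.comp]
    ring
  · rw [dif_neg h]
    refine Finset.sum_eq_zero fun p hp => ?_
    exfalso
    simp only [mem_filter, mem_univ, true_and] at hp
    apply h
    rw [← hp.2, occupied_rangePattern, card_image_of_injective _ hp.1, card_univ, Fintype.card_fin]

/-! ### Norm = Gram determinant -/

/-- **Norm of a Slater determinant state** = Gram determinant of the orbitals:
`∑ₓ |slaterState φ x|² = det (Φ Φᴴ)`, `Φ = [φ a j]` (Cauchy–Binet; Löwdin's overlap formula).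
[folklore] -/
theorem normSq_slaterState (φ : Fin k → Fin n → ℂ) :
    (normSq (slaterState φ) : ℂ) = (Matrix.of φ * (Matrix.of φ)ᴴ).det := by
  rw [det_mul_eq_sum_occupied, Cryptography.normSq, Complex.ofReal_sum]
  refine Finset.sum_congr rfl fun x _ => ?_
  rw [← Complex.normSq_eq_norm_sq, ← Complex.mul_conj]
  by_cases h : (occupied x).card = k
  · rw [dif_pos h, slaterState_of_card_eq _ h, ← conjTranspose_submatrix, det_conjTranspose]
    rfl
  · rw [dif_neg h, slaterState_of_card_ne _ h, zero_mul]

/-- Orthonormal orbitals (`Φ Φᴴ = 1`) give a unit vector. [folklore] -/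
theorem normSq_slaterState_of_orthonormal (φ : Fin k → Fin n → ℂ)
    (hφ : Matrix.of φ * (Matrix.of φ)ᴴ = 1) : normSq (slaterState φ) = 1 := by
  have h := normSq_slaterState φ
  rw [hφ, det_one] at h
  exact_mod_cast h

/-! ### The two Fermi seas of route FermionicMagic -/

/-- **The half-filled chiral Fermi sea on the ring** `ℤ/n`: the Slater determinant state of the
`k = ⌊n/2⌋` plane waves `φ_a(j) = e^{2πi a j/n}/√n`, `a = 0, …, k-1`; its amplitude on occupied
sites `j₀ < ⋯ < j_{k-1}` is `n^{-k/2} ∏_{b<b'} (ω^{j_{b'}} - ω^{j_b})`, `ω = e^{2πi/n}`.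
(Route QuantumAdvantage/FermionicMagic, items `FermiSeaApproxRank`, `FermiSeaPrep`, which inline
this lambda.) [folklore] -/
def ringFermiSea (n : ℕ) : QReg n → ℂ :=
  slaterState fun (a : Fin (n / 2)) (j : Fin n) =>
    Complex.exp (2 * (Real.pi : ℂ) * Complex.I * ((a : ℕ) : ℂ) * (((j : Fin n) : ℕ) : ℂ) / (n : ℂ)) /
      (Real.sqrt (n : ℝ) : ℂ)

/-- **The Fermi ball of the hypercube** `Q_r`: the sites `a < 2^r`, read as `r`-bit strings, of
Hamming weight `|a|` with `2|a| < r`: the labels of the Walsh characters `χ_a`, eigenvectors of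
the adjacency operator of `Q_r` with eigenvalue `r - 2|a| > 0`, i.e. the single-particle levels
below the Fermi level of fermions hopping on `Q_r` (hopping amplitude `-1`, half filling; for odd
`r` exactly half of the `2^r` levels). [Bernard–Crampé–Vinet 2023, §2.1 eq. (14) (eigenspaces of
`H(d,q)` labelled by `b ∈ 𝔽₂^d` of weight `k`), §2.2 (the set `S_E` of filled levels)]
[cite: BernardCrampeVinet2023, §2.1 eq. (14)] -/
def fermiBall (r : ℕ) : Finset (Fin (2 ^ r)) :=
  Finset.univ.filter fun a : Fin (2 ^ r) => 2 * (Nat.digits 2 (a : ℕ)).sum < r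

/-- The normalised **Walsh character** `χ_a(j) = (-1)^{|a ∧ j|}/√(2^r)` on `r`-bit strings
(`|a ∧ j|` = number of common `1`-bits, via `Nat.land` and binary digits): the eigenfunctions
of hopping on the hypercube `Q_r` (tensor products of `(|0⟩ ± |1⟩)/√2`).
[Bernard–Crampé–Vinet 2023, §2.1 eqs. (12)–(14)] [folklore] -/
def walsh (r : ℕ) (a j : Fin (2 ^ r)) : ℂ :=
  (-1 : ℂ) ^ (Nat.digits 2 ((a : ℕ) &&& (j : ℕ))).sum / (Real.sqrt (2 ^ r : ℝ) : ℂ)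

/-- **The half-filled Fermi sea of the hypercube** `Q_r` on `n = 2^r` qubits: the Slater
determinant state of the Walsh characters `χ_a`, `a ∈ fermiBall r` enumerated increasingly —
the ground state `|Ψ₀⟩⟩ = ∏_{levels below the Fermi level} c̄† |0⟩⟩` of free fermions hopping on
`Q_r = H(r,2)`; its amplitudes are `|K| × |K|` minors of the Sylvester–Hadamard matrix over
`2^{r|K|/2}`, `K = fermiBall r`. (Route QuantumAdvantage/FermionicMagic, items `CubeSeaExactRank`,
`CubeSeaApproxRank`, `CubeSeaPrep`, which inline this lambda.)
[cite: BernardCrampeVinet2023, §2.2 eq. (19)] -/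
def cubeFermiSea (r : ℕ) : QReg (2 ^ r) → ℂ :=
  slaterState fun (p : Fin (fermiBall r).card) (j : Fin (2 ^ r)) =>
    walsh r ((fermiBall r).orderEmbOfFin rfl p) j

/-- `ringFermiSea` unfolded to the route's inline form. [folklore] -/
theorem ringFermiSea_eq (n : ℕ) : ringFermiSea n = fun x : QReg n =>
    if h : (Finset.univ.filter fun j : Fin n => x j = true).card = n / 2 then
      (Matrix.of fun a b : Fin (n / 2) => Complex.exp (2 * (Real.pi : ℂ) * Complex.I * ((a : ℕ) : ℂ) *
        ((((Finset.univ.filter fun j : Fin n => x j = true).orderEmbOfFin h b : Fin n) : ℕ) : ℂ) /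
          (n : ℂ)) / (Real.sqrt (n : ℝ) : ℂ)).det
    else 0 := rfl

/-- `cubeFermiSea` unfolded to the route's inline form. [folklore] -/
theorem cubeFermiSea_eq (r : ℕ) : cubeFermiSea r = fun x : QReg (2 ^ r) =>
    if h : (Finset.univ.filter fun j : Fin (2 ^ r) => x j = true).card =
        (Finset.univ.filter fun a : Fin (2 ^ r) => 2 * (Nat.digits 2 (a : ℕ)).sum < r).card then
      (Matrix.of fun p q => (-1 : ℂ) ^ (Nat.digits 2 ((((Finset.univ.filter fun a : Fin (2 ^ r) =>
        2 * (Nat.digits 2 (a : ℕ)).sum < r).orderEmbOfFin rfl p : Fin (2 ^ r)) : ℕ) &&&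
          (((Finset.univ.filter fun j : Fin (2 ^ r) => x j = true).orderEmbOfFin h q :
            Fin (2 ^ r)) : ℕ))).sum / (Real.sqrt (2 ^ r : ℝ) : ℂ)).det
    else 0 := rfl

/-- The ring Fermi sea lives in the `⌊n/2⌋`-particle sector. [folklore] -/
theorem ringFermiSea_of_card_ne {n : ℕ} {x : QReg n} (h : (occupied x).card ≠ n / 2) :
    ringFermiSea n x = 0 :=
  slaterState_of_card_ne _ h

/-- The hypercube Fermi sea lives in the `|fermiBall r|`-particle sector. [folklore] -/
theorem cubeFermiSea_of_card_ne {r : ℕ} {x : QReg (2 ^ r)} (h : (occupied x).card ≠ (fermiBall r).card) :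
    cubeFermiSea r x = 0 :=
  slaterState_of_card_ne _ h

end Literature.Computability.QuantumComplexity
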